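import Summits.BirchSwinnertonDyer.BirchSwinnertonDyer.Theorems.KimAtThreeDeepUpperUniformOfFineKato
import Summits.BirchSwinnertonDyer.BirchSwinnertonDyer.Theorems.KimAtThreeDeepLowerPortDeepTorsionUpperEngine
import Summits.BirchSwinnertonDyer.BirchSwinnertonDyer.Theorems.KimAtThreeDeepLowerKatoStratumOfFacts
import HarnessLib

/-!
# Route `KimAtThreeKolyvagin` (rung W2): crux `DeepUpperAtThree` (19076) BY NAME from the route's OWN four
# published leaves — `SakamotoKolyvaginThree` ([S24] Thm. 4.4 (1)(2) PINNED), `RankEqAnalyticRankLeOne`,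
# `PoitouTateSelmerDuality`, `CarayolLevelEqConductor` — and the ONE uniform fine Kato package (C1ᵤ);
# NO S24-DEEP port (cell `bsd-addord`, seat w2-c3 gen 7)

HONEST FRAMING: glue theorems with DISPLAYED hypotheses (no definition, no named fact, no `sorry`); the
conclusions are route decls BY NAME but CONDITIONAL on the displayed package (C1ᵤ), so NOTHING is closed and
nothing is booked; BSD is not proved by any of this.

## What, and why

Gen 6 of this seat (`KimAtThreeDeepUpperUniformOfFineKato`, p487287) derived crux 19076 from (C1ᵤ), Carayol,
GZK, Poitou–Tate and the two S24-DEEP PORTS `S24Deep.kolyvaginSystems_freeRankOne_zmod_three_pow_deep` /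
`…_idealOfBasis_eq_fittingIdeal_zmod_three_pow_deep` (Summits-side typed hypotheses, FLAG `S24-DEEP-PORT@3` —
NOT the route's registered leaf `SakamotoKolyvaginThree`, item 19558).  Seat w2-c2 gen 6 then re-ran seat
acc1's deep UPPER engine on the PINNED Literature facts (`KimAtThreeDeepLowerPortDeepTorsionUpperEngine.
deepUpper_conclusion_of_port_e_deep_pinned`: the deep generator family from
`KimAtThreeDeepLowerDeepFamilyOfPinned.exists_deepFamily_of_pinned_with`, base depth one deeper).  The port
family that engine consumes — `∀ k Dk, Dk.IsCanonicalTauDatumThreeAtWith W (k + t) k η → ∃ κ Λ κ′,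
KatoKuriharaWitnessAt W k e Dk v₃ P κ Λ κ′` for SOME `t e` — is LITERALLY the output of gen 6's
`portFamilyDeep_of_fineKatoUniform` (from (C1ᵤ) + the class-wide certificate supply `certSupply_uniform`).
Composing the two:
* `deepUpper_datum_of_poitouTate_of_port_e_deep_pinned` — acc1's row wrapper
  (`KimAtThreeDeepUpperAdditiveDefectOfPortEDeep.deepUpper_datum_of_poitouTate_of_port_e_deep`) with
  `hS24d hS24d₂ ↦ hS24 hS24₂` (PINNED): the Poitou–Tate families from the named fact, `L(E,1) ≠ 0` from
  `ord(δ̃) = 0`, then w2-c2's pinned engine.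
* `deepUpper_optimalRow_of_pinnedFacts_of_fineKatoUniform` — 19076's conclusion at EVERY tower row with a
  lattice-optimal datum at the conductor ⟸ [S24] (1)(2) PINNED, GZK, Poitou–Tate, (C1ᵤ).
* `deepUpperAtThreeOffKatoStratum_of_pinnedFacts_of_fineKatoUniform` — crux 19562 BY NAME (verbatim corollary).
* ★ `deepUpperAtThree_of_pinnedFacts_of_fineKatoUniform` — crux 19076 BY NAME ⟸ (C1ᵤ), Carayol, [S24] (1)(2)
  PINNED, GZK, Poitou–Tate.
* ★★ `deepUpperAtThree_of_leaves_of_fineKatoUniform : (C1ᵤ) → SakamotoKolyvaginThree → RankEqAnalyticRankLeOne →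
  PoitouTateSelmerDuality → CarayolLevelEqConductor → DeepUpperAtThree` — the same in the ROUTE's currency: the
  four antecedents are the route's registered cite-only children 19558 / 19921 / 19559 / 19467 BY NAME.
NET: on the (C1ᵤ) road crux 19076 rests on the route's four published leaves and (C1ᵤ) ALONE — no
S24-DEEP, no PORT″ (19560), no stub (19561), no (C3)/SAT₀, no (DD)/(U′)/Wuthrich/Kato 14.5(3)/BSD₃.
HONEST LIMITS: (C1ᵤ) is construction-shaped (axioms on bound witnesses; model = Kato's Euler system of `T₃E`
read through the Bloch–Kato dual exponential at finite level: Kato Thm 9.7 ∘ 6.6 (1) + [BK90] Prop. 3.8 /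
Ex. 3.11 + the crude bound `3·exp*_ω(H¹(K,T)) ⊆ 𝒪_K` — definition items `defn-BlochKatoDualExponential` (DONE,
p485577) / `defn-EllipticNeronDeRhamClass` (OPEN)); the four leaves are cite-only named facts; nothing is closed.
References: [Kato2004Asterisque] (8.1.3), Prop. 8.12, §9.4, Thm. 9.7, Thm. 6.6 (1), Ex. 13.3;
[Kim2022StructureSelmer] Lemma 3.4, Thm. 3.13, §2.2.2; [Kim2025RefinedTNC] Thm 1.1; [MazurRubin2004] Thm. 4.4.1,
App. A Prop. A.2; [Sakamoto2024] Thm. 4.4 (1)(2); [MilneADT2006] I.4.10; [Carayol1986]; memo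
HOME/w2c3/W2C3-UNIFORM-PORT-g6.md (gen 6) and this gen's HANDOFF. -/

set_option autoImplicit false
-- the Theorems namespace of a single-conjunct summit repeats the summit name by design (D-0017)
set_option linter.dupNamespace false

noncomputable section

open scoped NumberField TensorProduct ContRepresentation Classical
open CategoryTheory Field Function Finset IsDedekindDomain NumberField WeierstrassCurve
open Rat.HeightOneSpectrum
open Literature.NumberTheory.GaloisRepresentations Literature.NumberTheory.GaloisCohomology
open Literature.NumberTheory.GaloisRepresentations.DiscreteGaloisModule
open Literature.NumberTheory.EllipticCurves Literature.NumberTheory.EllipticCurves.ModularForms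
open Literature.NumberTheory.EllipticCurves.Rank1Residual
open Literature.NumberTheory.EllipticCurves.Kato2004
open Literature.NumberTheory.EllipticCurves.Kato2004.EulerSystemValues
open Summit.BirchSwinnertonDyer.Rank1Residual.GaloisImage
open Summit.BirchSwinnertonDyer.BirchSwinnertonDyer.Theses.KimAtThreeKolyvagin
open Summit.BirchSwinnertonDyer.BirchSwinnertonDyer.Theorems.KimAtThreeDeepUpperUniformOfFineKato
open Summit.BirchSwinnertonDyer.BirchSwinnertonDyer.Theorems.KimAtThreeDeepLowerPortDeepTorsionUpperEngine
open Summit.BirchSwinnertonDyer.BirchSwinnertonDyer.Theorems.KimAtThreeDeepLowerKatoStratumOfFacts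

namespace Summit.BirchSwinnertonDyer.BirchSwinnertonDyer.Theorems.KimAtThreeDeepUpperUniformPinned

/-- Local notation: the TWO-EXPONENT rider clause (ii₂) at depth `j`, torsion exponent `t`, defect exponent
`e`, place `v`, for the pair `(Λ, Λf)` — seat acc6's spelling (`KimAtThreeTwoExponentWitnessPair`), copied
VERBATIM from gen 6's `KimAtThreeDeepUpperUniformOfFineKato`. -/
local notation3 (prettyPrint := false) "RIDER₂⟦" W' ", " j ", " t' ", " e' ", " v' ", " Λ' ", " Λf "⟧" =>
  ∀ (r : Finset (HeightOneSpectrum (𝓞 ℚ)))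
    (Ψ : H1 (tateRep W' 3) (cycSubgroup 3 0 r) →+
      continuousCohomology 1
        (subgroupRep (WeierstrassCurve.torsionGaloisModule W' (((3 : ℕ) : ℤ) ^ j * ((3 : ℕ) : ℤ))).toTopRep
          (cycSubgroup 3 0 r))),
    (∀ (φ : contOneCocycles (subgroupRep (tateRep W' 3).toTopRep (cycSubgroup 3 0 r)))
        (ψ : contOneCocycles
          (subgroupRep (WeierstrassCurve.torsionGaloisModule W' (((3 : ℕ) : ℤ) ^ j * ((3 : ℕ) : ℤ))).toTopRep
            (cycSubgroup 3 0 r))),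
        (∀ g, ((ψ.1 g : geomTorsion W' (((3 : ℕ) : ℤ) ^ j * ((3 : ℕ) : ℤ))) : geomPoints W') =
          TateModule.proj 3 (j + 1) (φ.1 g)) →
        Ψ (oneCocycleClass _ φ) = oneCocycleClass _ ψ) →
    ∀ (y : H1 (tateRep W' 3) (cycSubgroup 3 0 r))
      (κ₀ : galoisCohomology (WeierstrassCurve.torsionGaloisModule W' (((3 : ℕ) : ℤ) ^ j * ((3 : ℕ) : ℤ))) 1)
      (s : ℤ_[3]),
      resSubgroup (WeierstrassCurve.torsionGaloisModule W' (((3 : ℕ) : ℤ) ^ j * ((3 : ℕ) : ℤ))).toTopRep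
          (cycSubgroup 3 0 r) 1 κ₀ = Ψ y →
      galoisCohomology.localization (WeierstrassCurve.torsionGaloisModule W' (((3 : ℕ) : ℤ) ^ j * ((3 : ℕ) : ℤ)))
          (Sum.inr v') 1 κ₀ ∈ propagatedSelmerStructure W' 3 j (Sum.inr v') →
      (∃ l ∈ cycIntLattice 3 (cycLevel 3 0 r),
          (((3 : ℕ) : ℤ_[3]) ^ t') • Λ' 0 r y - ((s : ℚ_[3]) ⊗ₜ[ℚ] (1 : CyclotomicField (cycLevel 3 0 r) ℚ)) =
            (((3 : ℕ) : ℤ_[3]) ^ (j + 1)) • (l : ℚ_[3] ⊗[ℚ] CyclotomicField (cycLevel 3 0 r) ℚ)) →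
      ((3 ^ e' : ℕ) : ZMod (3 ^ (j + 1))) *
        Λf (galoisCohomology.localization
          (WeierstrassCurve.torsionGaloisModule W' (((3 : ℕ) : ℤ) ^ j * ((3 : ℕ) : ℤ))) (Sum.inr v') 1 κ₀) =
        PadicInt.toZModPow (j + 1) s

/-! ### §1 acc1's row wrapper on the PINNED facts -/

/-- **The UPPER row in n1011's dictionary currency from [S24] Thm. 4.4 (1)(2) PINNED + GZK + the Poitou–Tate
named fact + ONE deep-keyed port**, any datum, free `t` and `e` — seat acc1's
`deepUpper_datum_of_poitouTate_of_port_e_deep` with `hS24d hS24d₂` (S24-DEEP ports) replaced by the pinned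
Literature facts, through seat w2-c2's `deepUpper_conclusion_of_port_e_deep_pinned` (proof text acc1's: the
Poitou–Tate families at level `3` and at every `3^{k′+1}` from `hPT`, `L(E,1) ≠ 0` from `ord(δ̃) = 0`).
[cite: Kim2025RefinedTNC, Thm 1.1] [cite: MilneADT2006, Ch. I, Thm. 4.10]
[cite: Kim2022StructureSelmer, Thm. 1.9 (6), Thm. 3.13] [cite: Sakamoto2024, Thm. 4.4 (1)(2) (p. 926)]
[cite: MazurRubin2004, Thm. 4.4.1 and App. A Prop. A.2] -/
theorem deepUpper_datum_of_poitouTate_of_port_e_deep_pinned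
    (hS24 : Sakamoto2024.kolyvaginSystems_freeRankOne_zmod_three_pow)
    (hS24₂ : Sakamoto2024.kolyvaginSystems_idealOfBasis_eq_fittingIdeal_zmod_three_pow)
    (hGZK : rank_eq_analyticRank_of_analyticRank_le_one)
    (hPT : poitouTate_selmerStructure_duality ℚ)
    (W : WeierstrassCurve ℚ) [W.IsElliptic] [W.IsGloballyMinimal]
    (htower : ∀ m : ℕ, W.HasSurjectiveModNGaloisRep (3 ^ m : ℕ))
    {N : ℕ} [NeZero N] (D : ModularParametrizationData W N)
    (hint : ∀ r : ℚ, ratPlusSymbol D.f r ≠ 0 → 0 ≤ padicValRat 3 (ratPlusSymbol D.f r))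
    (hord : kuriharaVanishingOrder W 3 D.f = 0)
    (v₃ : HeightOneSpectrum (𝓞 ℚ)) (hv₃ : ((3 : ℕ) : 𝓞 ℚ) ∈ v₃.asIdeal)
    (η : (q : HeightOneSpectrum (𝓞 ℚ)) → (ZMod (Ideal.absNorm q.asIdeal))ˣ)
    (hη : ∀ q : HeightOneSpectrum (𝓞 ℚ), Subgroup.zpowers (η q) = ⊤)
    (t e : ℕ)
    (hPort : ∀ (k : ℕ)
      (Dk : KolyvaginDatum (W.torsionGaloisModule (((3 : ℕ) : ℤ) ^ k * ((3 : ℕ) : ℤ)))),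
      Dk.IsCanonicalTauDatumThreeAtWith W (k + t) k η →
      ∃ (κ : Finset (HeightOneSpectrum (𝓞 ℚ)) →
            galoisCohomology (W.torsionGaloisModule (((3 : ℕ) : ℤ) ^ k * ((3 : ℕ) : ℤ))) 1)
        (Λ : galoisCohomology ((W.torsionGaloisModule (((3 : ℕ) : ℤ) ^ k * ((3 : ℕ) : ℤ))).toLocal
            (Sum.inr v₃)) 1 →+ ZMod (3 ^ (k + 1)))
        (κ' : Finset (HeightOneSpectrum (𝓞 ℚ)) →
            galoisCohomology (W.torsionGaloisModule (((3 : ℕ) : ℤ) ^ k * ((3 : ℕ) : ℤ))) 1),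
        KatoKuriharaWitnessAt W k e Dk v₃ D κ Λ κ') :
    ∃ dd : ℕ, kuriharaPartialDeepInfty W 3 D.f = dd ∧
      ((padicValNat 3 (Nat.card (AddCommGroup.primaryComponent W.sha 3)) + dd : ℕ) : ℕ∞) ≤
        kuriharaPartial W 3 D.f 0 := by
  haveI : Fact (Nat.Prime 3) := ⟨Nat.prime_three⟩
  have h0 : ratPlusSymbol D.f 0 ≠ 0 :=
    KimAtThreeKolyvaginUnitLevelOneRungs.ratPlusSymbol_zero_ne_zero_of_kuriharaVanishingOrder_eq_zero W 3 D.f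
      hord
  have hL : W.entireLFunction 1 ≠ 0 :=
    D.isNewformOf.entireLFunction_one_ne_zero_of_ratPlusSymbol_zero_ne_zero h0
  obtain ⟨inv, hperf, hsum, -, hcompl⟩ := hPT 3
  obtain ⟨inv', hperf', hsum', hcompl', hinj'⟩ := exists_localInvariants_three_pow_of_poitouTate hPT
  exact deepUpper_conclusion_of_port_e_deep_pinned hS24 hS24₂ hGZK W htower hL D hint inv hperf hsum hcompl
    inv' hperf' hsum' hcompl' hinj' v₃ hv₃ η hη t e hPort

/-! ### §2 EVERY tower row from (C1ᵤ) and the PINNED facts -/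

section Uniform

variable
  -- (C1ᵤ) the UNIFORM fine Kato package: coordinate `Λ = 3^{κe}·exp*_ω` (`v₃(κK) = κe ≥ 1`), rider clause (ii₂)
  -- at the row's exponents `(t, e)` — EVERY tower row, EVERY reduction type at `3`
  (hC1 : ∀ (W : WeierstrassCurve ℚ) [W.IsElliptic] [W.IsGloballyMinimal]
    [ContinuousSMul ℤ_[3] (W.tateModule 3)] [Module.Free ℤ_[3] (W.tateModule 3)]
    [Module.Finite ℤ_[3] (W.tateModule 3)],
    (∀ m : ℕ, W.HasSurjectiveModNGaloisRep (3 ^ m : ℕ)) →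
    ∀ (v₃ : HeightOneSpectrum (𝓞 ℚ)), ((3 : ℕ) : 𝓞 ℚ) ∈ v₃.asIdeal →
    ∀ {N : ℕ} [NeZero N] (P : ModularParametrizationData W N), N = W.conductorNorm ℤ →
      (∀ z ∈ P.L.lattice, ∃ w ∈ periodLattice P.f, z = P.c * w) →
      ∃ (t e κe : ℕ) (ι : (n : ℕ) → (CyclotomicField n ℚ →+* ℂ)) (κK : ℝ)
        (Λ : ∀ (k' : ℕ) (r : Finset (HeightOneSpectrum (𝓞 ℚ))),
          H1 (tateRep W 3) (cycSubgroup 3 k' r) →ₗ[ℤ_[3]] ℚ_[3] ⊗[ℚ] CyclotomicField (cycLevel 3 k' r) ℚ)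
        (Λfin : ∀ j : ℕ, galoisCohomology
          ((W.torsionGaloisModule (((3 : ℕ) : ℤ) ^ j * ((3 : ℕ) : ℤ))).toLocal (Sum.inr v₃)) 1 →+
            ZMod (3 ^ (j + 1))),
        κK ≠ 0 ∧ (∃ u : ℚ, (u : ℝ) = κK ∧ padicValRat 3 u = κe ∧ 1 ≤ κe) ∧
        (∀ j : ℕ,
          (∀ c : ZMod (3 ^ (j + 1)), ∃ x ∈ propagatedSelmerStructure W 3 j (Sum.inr v₃), Λfin j x = c) ∧
          (∀ x ∈ propagatedSelmerStructure W 3 j (Sum.inr v₃),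
            Λfin j x = 0 ↔ x ∈ W.kummerSelmerStructure (((3 : ℕ) : ℤ) ^ j * ((3 : ℕ) : ℤ)) (Sum.inr v₃))) ∧
        (∀ j : ℕ, RIDER₂⟦W, j, t, e, v₃, Λ, Λfin j⟧) ∧
        ∀ (c d a : ℤ) (A : ℕ), 0 < A → Int.gcd c (6 * 3 * A) = 1 → Int.gcd d (6 * 3 * N) = 1 →
          ∃ (z : ∀ (k' : ℕ) (r : (cyclotomicLevelsRat 3 (badPlaces c d A N)).Ideals),
                H1 (tateRep W 3) ((cyclotomicLevelsRat 3 (badPlaces c d A N)).level k' r.1))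
            (x : ∀ (k' : ℕ) (r : (cyclotomicLevelsRat 3 (badPlaces c d A N)).Ideals),
                CyclotomicField (cycLevel 3 k' r.1) ℚ),
            ZetaBody W 3 P.f ι κK Λ c d a A z x)

include hC1

/-- **Crux 19076's conclusion at EVERY tower row with `Ш` finite and a lattice-optimal datum at the conductor
(`3`-integral plus symbols, `ord(δ̃) = 0`), from [S24] Thm. 4.4 (1)(2) PINNED, GZK, Poitou–Tate and (C1ᵤ)
ALONE** — gen 6's `deepUpper_optimalRow_of_deepFacts_of_fineKatoUniform` with the S24-DEEP ports replaced by
the pinned facts: (C2ᵤ) is gen 6's THEOREM `certSupply_uniform`, the port family is gen 6's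
`portFamilyDeep_of_fineKatoUniform`, the END is §1.  NO reduction-type case split, NO PORT″, NO stub, NO (C3),
NO (DD), NO Manin / period / `c₃` / local-torsion hypothesis.
[cite: Kim2025RefinedTNC, Thm 1.1] [cite: Kim2022StructureSelmer, Thm. 3.13, Lemma 3.4 and §2.2.2]
[cite: Sakamoto2024, Thm. 4.4 (1)(2) (p. 926)] [cite: MilneADT2006, Ch. I, Thm. 4.10]
[cite: Kato2004Asterisque, (8.1.3), §9.4, Thm. 9.7 and Ex. 13.3] -/
theorem deepUpper_optimalRow_of_pinnedFacts_of_fineKatoUniform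
    (hS24 : Sakamoto2024.kolyvaginSystems_freeRankOne_zmod_three_pow)
    (hS24₂ : Sakamoto2024.kolyvaginSystems_idealOfBasis_eq_fittingIdeal_zmod_three_pow)
    (hGZK : rank_eq_analyticRank_of_analyticRank_le_one)
    (hPT : poitouTate_selmerStructure_duality ℚ) :
    ∀ (W₀ : WeierstrassCurve ℚ) [W₀.IsElliptic] [W₀.IsGloballyMinimal],
      (∀ n : ℕ, W₀.HasSurjectiveModNGaloisRep (3 ^ n : ℕ)) → Finite W₀.sha →
      ∀ {N : ℕ} [NeZero N], N = W₀.conductorNorm ℤ →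
      ∀ (D₀ : Literature.NumberTheory.EllipticCurves.ModularForms.ModularParametrizationData W₀ N),
        (∀ z ∈ D₀.L.lattice, ∃ w ∈ Literature.NumberTheory.EllipticCurves.ModularForms.periodLattice D₀.f, z = D₀.c * w) →
        (∀ r : ℚ, Literature.NumberTheory.EllipticCurves.ratPlusSymbol D₀.f r ≠ 0 →
          0 ≤ padicValRat 3 (Literature.NumberTheory.EllipticCurves.ratPlusSymbol D₀.f r)) →
        Literature.NumberTheory.EllipticCurves.kuriharaVanishingOrder W₀ 3 D₀.f = 0 →
        ∃ d : ℕ, Literature.NumberTheory.EllipticCurves.kuriharaPartialDeepInfty W₀ 3 D₀.f = d ∧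
          ((padicValNat 3 (Nat.card (AddCommGroup.primaryComponent W₀.sha 3)) + d : ℕ) : ℕ∞) ≤
            Literature.NumberTheory.EllipticCurves.kuriharaPartial W₀ 3 D₀.f 0 := by
  intro W₀ _ _ htow _ N _ hN D₀ hopt hint hord
  obtain ⟨v₃, η, hv₃, hη⟩ := KimAtThreeShallowEqDeepSplitGlueNoStub.exists_place_three_and_generators
  obtain ⟨t, e, hPort⟩ := portFamilyDeep_of_fineKatoUniform hC1
    (fun W _ _ htow' _ _ P _ _ => certSupply_uniform W htow' P) W₀ htow v₃ hv₃ η hη D₀ hN hopt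
  exact deepUpper_datum_of_poitouTate_of_port_e_deep_pinned hS24 hS24₂ hGZK hPT W₀ htow D₀ hint hord v₃ hv₃ η
    hη t e hPort

/-- **Crux `DeepUpperAtThreeOffKatoStratum` (stmt-BirchSwinnertonDyer-19562) BY NAME from [S24] Thm. 4.4 (1)(2)
PINNED, GZK, Poitou–Tate and (C1ᵤ)** — the row theorem VERBATIM (its `hoff` and degree-minimality binders are
idle: the road is uniform).  Conditional; nothing is booked.
[cite: Kim2025RefinedTNC, Thm 1.1] [cite: Sakamoto2024, Thm. 4.4 (1)(2) (p. 926)] [cite: MilneADT2006, Ch. I, Thm. 4.10] -/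
theorem deepUpperAtThreeOffKatoStratum_of_pinnedFacts_of_fineKatoUniform
    (hS24 : Sakamoto2024.kolyvaginSystems_freeRankOne_zmod_three_pow)
    (hS24₂ : Sakamoto2024.kolyvaginSystems_idealOfBasis_eq_fittingIdeal_zmod_three_pow)
    (hGZK : rank_eq_analyticRank_of_analyticRank_le_one)
    (hPT : poitouTate_selmerStructure_duality ℚ) :
    Summit.BirchSwinnertonDyer.BirchSwinnertonDyer.Theses.KimAtThreeKolyvagin.DeepUpperAtThreeOffKatoStratum :=
  fun W₀ _ _ htow hfin _ _ hN D₀ hopt _ hint hord _ =>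
    deepUpper_optimalRow_of_pinnedFacts_of_fineKatoUniform hC1 hS24 hS24₂ hGZK hPT W₀ htow hfin hN D₀ hopt hint
      hord

/-- ★ **Crux `DeepUpperAtThree` (stmt-BirchSwinnertonDyer-19076) BY NAME from (C1ᵤ), Carayol, [S24] Thm. 4.4
(1)(2) PINNED, GZK and Poitou–Tate** — kim3's transport to optimal data at the conductor
(`deepUpperAtThree_of_forall_optimalDatum_atConductor`) fed the row theorem.  NO S24-DEEP port, NO Kato-stratum /
off-stratum split, NO PORT″ / stub / (C3), NO (DD) / Wuthrich / BSD₃.  Conditional; nothing is booked.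
[cite: Kim2025RefinedTNC, Thm 1.1] [cite: Sakamoto2024, Thm. 4.4 (1)(2) (p. 926)] [cite: Carayol1986]
[cite: Kato2004Asterisque, (8.1.3) (p. 180), §9.4 and Thm. 9.7 (pp. 188–189), Ex. 13.3 (pp. 224–225)] [cite: MilneADT2006, Ch. I, Thm. 4.10] -/
theorem deepUpperAtThree_of_pinnedFacts_of_fineKatoUniform
    (hlev : CarayolLevelEqConductor)
    (hS24 : Sakamoto2024.kolyvaginSystems_freeRankOne_zmod_three_pow)
    (hS24₂ : Sakamoto2024.kolyvaginSystems_idealOfBasis_eq_fittingIdeal_zmod_three_pow)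
    (hGZK : rank_eq_analyticRank_of_analyticRank_le_one)
    (hPT : poitouTate_selmerStructure_duality ℚ) :
    Summit.BirchSwinnertonDyer.BirchSwinnertonDyer.Theses.KimAtThreeKolyvagin.DeepUpperAtThree :=
  KimAtThreeKolyvaginIsogenyCruxes.deepUpperAtThree_of_forall_optimalDatum_atConductor hlev
    fun W₀ _ _ htow hfin _ _ hN D₀ hopt _ hint hord =>
      deepUpper_optimalRow_of_pinnedFacts_of_fineKatoUniform hC1 hS24 hS24₂ hGZK hPT W₀ htow hfin hN D₀ hopt
        hint hord

/-- ★★ **Crux `DeepUpperAtThree` (stmt-BirchSwinnertonDyer-19076) BY NAME, in the ROUTE's currency: from (C1ᵤ) and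
the route's four registered cite-only children BY NAME** — `SakamotoKolyvaginThree` (19558: [S24] Thm. 4.4 (1) ∧
(2) PINNED), `RankEqAnalyticRankLeOne` (19921: GZK), `PoitouTateSelmerDuality` (19559: Milne I.4.10(b)),
`CarayolLevelEqConductor` (19467).  With (C1ᵤ) discharged this is the glue the route's split asks for minus every
other child (19560 PORT″, 19561 stub, 19562 off-stratum are bypassed).  Conditional; nothing is booked.
[cite: Kim2025RefinedTNC, Thm 1.1] [cite: Sakamoto2024, Thm. 4.4 (1)(2) (p. 926)] [cite: Carayol1986]
[cite: MilneADT2006, Ch. I, Thm. 4.10] [cite: Kato2004Asterisque, Thm. 9.7 (p. 189) and Ex. 13.3 (pp. 224–225)] -/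
theorem deepUpperAtThree_of_leaves_of_fineKatoUniform :
    SakamotoKolyvaginThree → RankEqAnalyticRankLeOne → PoitouTateSelmerDuality → CarayolLevelEqConductor →
      Summit.BirchSwinnertonDyer.BirchSwinnertonDyer.Theses.KimAtThreeKolyvagin.DeepUpperAtThree :=
  fun hSak hGZK hPT hlev =>
    deepUpperAtThree_of_pinnedFacts_of_fineKatoUniform hC1 hlev hSak.1 hSak.2 hGZK hPT

end Uniform

end Summit.BirchSwinnertonDyer.BirchSwinnertonDyer.Theorems.KimAtThreeDeepUpperUniformPinned

end
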